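import Summits.QuantumFields.YangMills.Theses.PencilRigidity
import Summits.QuantumFields.YangMills.Theorems.PencilRigidityCurvatureKernelBoundChartDerivativeBoundsFrame
import Literature.MathematicalPhysics.QuantumFieldTheory.OSReconstructionNoE1

/-!
# `PencilRigidity.CurvatureChannel` (stmt-QuantumFields-9666): restriction and axis-frame transport

Closes the support item `Summit.QuantumFields.YangMills.Theses.PencilRigidity.CurvatureChannel`
(shared verbatim with route `MirrorModularBoosts`).

* **Restriction.** If `(r, sch, S)` satisfies the `HypercubicLimit` clauses, the curvature
  channel `S₁ n := S n (fun _ => r.curvature)` satisfies the one-species package `W₁`: every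
  clause is the label specialisation of the corresponding clause of `S` (E0, E0' with the label
  alphabet `{r.curvature}`, E2/E4 after `Fin.append (const ∘ Fin.rev) const = const`, E3,
  translations, proper hypercubic invariance, the lattice convergence of the curvature strings,
  and the gap by `LabelledSchwingerFamily.HasMassGap.restrict`).
* **Transport.** `S₁` is reflection positive in pull-back form `n ↦ S₁ n ∘ linActMulti R` for
  every frame `R` with `R e₀ ∈ {±e₀, ±e₁}`: there is a proper signed permutation `g` (a product
  of two hyperplane reflections, determinant `1`) with `g (R e₀) = e₀`; by proper hypercubic
  invariance on `⁰𝒮` the pull-backs by `R` and by `R.trans g` have the same OS sums (OS tensor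
  witnesses of time-ordered functions are off-diagonal); and `R.trans g` fixes `e₀`, hence
  preserves the time coordinate, commutes with the time reflection, maps time-ordered test
  functions to time-ordered ones and OS witnesses to OS witnesses, so E2 of `S` applies.
  (Osterwalder–Schrader 1973, §3 (E1)–(E2); Glimm–Jaffe 1987, §6.1.)
-/

noncomputable section

open scoped SchwartzMap ComplexConjugate BigOperators InnerProductSpace
open MeasureTheory Filter Topology Complex
open Literature.MathematicalPhysics.AQFT Literature.MathematicalPhysics.QuantumLattice
open Literature.MathematicalPhysics.QuantumFieldTheory

namespace Summit.QuantumFields.YangMills.Theorems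

namespace CurvatureChannel

/-! ### Constant label strings -/

/-- `Fin.append` of two constant strings with the same value is the constant string. -/
theorem append_const_rev {α : Type*} {n m : ℕ} (c : α) :
    Fin.append ((fun _ : Fin n => c) ∘ Fin.rev) (fun _ : Fin m => c) = fun _ => c := by
  funext i
  refine Fin.addCases (fun j => ?_) (fun j => ?_) i
  · simp
  · simp

/-! ### Isometries fixing the time axis -/

section TimeAxis

variable {d : ℕ} [NeZero d]

local notation "𝔼" => EuclideanSpace ℝ (Fin d)

/-- The time coordinate is the inner product with `e₀`. -/
theorem apply_zero_eq_inner (x : 𝔼) : x 0 = ⟪(EuclideanSpace.single 0 (1 : ℝ) : 𝔼), x⟫_ℝ := by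
  rw [EuclideanSpace.inner_single_left]
  simp

/-- An isometry fixing `e₀` preserves the time coordinate. -/
theorem apply_zero_of_map_e0 {Q : 𝔼 ≃ₗᵢ[ℝ] 𝔼}
    (hQ : Q (EuclideanSpace.single 0 1) = EuclideanSpace.single 0 1) (x : 𝔼) : Q x 0 = x 0 := by
  rw [apply_zero_eq_inner, apply_zero_eq_inner x]
  conv_lhs => rw [← hQ]
  exact Q.inner_map_map _ _

/-- The inverse of an isometry fixing `e₀` fixes `e₀`. -/
theorem symm_map_e0 {Q : 𝔼 ≃ₗᵢ[ℝ] 𝔼}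
    (hQ : Q (EuclideanSpace.single 0 1) = EuclideanSpace.single 0 1) :
    Q.symm (EuclideanSpace.single 0 1) = EuclideanSpace.single 0 1 := by
  conv_lhs => rw [← hQ]
  rw [LinearIsometryEquiv.symm_apply_apply]

/-- The time reflection is `x ↦ x − 2x⁰ e₀`. -/
theorem timeReflection_eq_sub_smul (x : 𝔼) :
    timeReflection d x = x - (2 * x 0) • (EuclideanSpace.single 0 (1 : ℝ) : 𝔼) := by
  ext i
  rw [timeReflection_apply]
  simp only [PiLp.sub_apply, PiLp.smul_apply, PiLp.single_apply, smul_eq_mul]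
  split_ifs with hi
  · subst hi; ring
  · ring

/-- An isometry fixing `e₀` commutes with the time reflection. -/
theorem map_timeReflection_of_map_e0 {Q : 𝔼 ≃ₗᵢ[ℝ] 𝔼}
    (hQ : Q (EuclideanSpace.single 0 1) = EuclideanSpace.single 0 1) (x : 𝔼) :
    Q (timeReflection d x) = timeReflection d (Q x) := by
  rw [timeReflection_eq_sub_smul, timeReflection_eq_sub_smul, map_sub, map_smul, hQ,
    apply_zero_of_map_e0 hQ]

/-- Pull-back by an isometry fixing `e₀` preserves time-ordering. -/
theorem isTimeOrdered_linActMulti_of_map_e0 {n : ℕ} {Q : 𝔼 ≃ₗᵢ[ℝ] 𝔼}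
    (hQ : Q (EuclideanSpace.single 0 1) = EuclideanSpace.single 0 1) {F : 𝓢((Fin n → 𝔼), ℂ)}
    (hF : IsTimeOrdered F) : IsTimeOrdered (linActMulti Q F) := by
  intro x hx
  have hφ : Continuous fun x : Fin n → 𝔼 => fun i => Q.symm (x i) :=
    continuous_pi fun i => Q.symm.continuous.comp (continuous_apply i)
  have hfun : ((linActMulti Q F : 𝓢((Fin n → 𝔼), ℂ)) : (Fin n → 𝔼) → ℂ) =
      (F : (Fin n → 𝔼) → ℂ) ∘ fun x : Fin n → 𝔼 => fun i => Q.symm (x i) := by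
    funext y
    rfl
  rw [hfun] at hx
  have hy := hF (tsupport_comp_subset_preimage (F : (Fin n → 𝔼) → ℂ) hφ hx)
  have h0 : ∀ i, Q.symm (x i) 0 = x i 0 := fun i => apply_zero_of_map_e0 (symm_map_e0 hQ) (x i)
  simp only [Set.mem_setOf_eq, h0] at hy
  exact hy

/-- Pull-back by an isometry fixing `e₀` commutes with the OS adjoint. -/
theorem osAdjoint_linActMulti_of_map_e0 {n : ℕ} {Q : 𝔼 ≃ₗᵢ[ℝ] 𝔼}
    (hQ : Q (EuclideanSpace.single 0 1) = EuclideanSpace.single 0 1) (F : 𝓢((Fin n → 𝔼), ℂ)) :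
    osAdjoint (linActMulti Q F) = linActMulti Q (osAdjoint F) := by
  ext x
  simp only [osAdjoint_apply, linActMulti_apply, map_timeReflection_of_map_e0 (symm_map_e0 hQ)]

omit [NeZero d] in
/-- Pull-back preserves tensor witnesses. -/
theorem isAppendTensorOf_linActMulti {n m : ℕ} (Q : 𝔼 ≃ₗᵢ[ℝ] 𝔼) {H : 𝓢((Fin (n + m) → 𝔼), ℂ)}
    {A : 𝓢((Fin n → 𝔼), ℂ)} {B : 𝓢((Fin m → 𝔼), ℂ)} (hH : IsAppendTensorOf H A B) :
    IsAppendTensorOf (linActMulti Q H) (linActMulti Q A) (linActMulti Q B) := by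
  intro x
  simp only [linActMulti_apply]
  exact hH _

/-- **Transport along the time axis.** If the one-species family `S₁` is reflection positive,
so is its pull-back `n ↦ S₁ n ∘ linActMulti Q` by any isometry `Q` fixing `e₀`. -/
theorem isReflectionPositive_comp_of_map_e0 (S₁ : SchwingerFamily 𝔼)
    (hRP : S₁.toLabelled.IsReflectionPositive) {Q : 𝔼 ≃ₗᵢ[ℝ] 𝔼}
    (hQ : Q (EuclideanSpace.single 0 1) = EuclideanSpace.single 0 1) :
    (SchwingerFamily.toLabelled (fun n => (S₁ n).comp (linActMulti Q))).IsReflectionPositive := by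
  intro N deg lab F hF H hH
  have h := hRP N deg lab (fun j => linActMulti Q (F j))
    (fun j => isTimeOrdered_linActMulti_of_map_e0 hQ (hF j)) (fun i j => linActMulti Q (H i j))
    (fun i j => by
      rw [osAdjoint_linActMulti_of_map_e0 hQ]
      exact isAppendTensorOf_linActMulti Q (hH i j))
  simpa only [SchwingerFamily.toLabelled_apply, ContinuousLinearMap.comp_apply] using h

/-- An OS tensor witness `H = ΘF* ⊗ G` of time-ordered `F, G` stays in `⁰𝒮` under every
pull-back. -/
theorem isOffDiagonal_linActMulti_of_isAppendTensorOf {n m : ℕ} (R : 𝔼 ≃ₗᵢ[ℝ] 𝔼)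
    {F : 𝓢((Fin n → 𝔼), ℂ)} {G : 𝓢((Fin m → 𝔼), ℂ)} {H : 𝓢((Fin (n + m) → 𝔼), ℂ)}
    (hF : IsTimeOrdered F) (hG : IsTimeOrdered G) (hH : IsAppendTensorOf H (osAdjoint F) G) :
    IsOffDiagonal (linActMulti R H) := by
  have hHeq : H = (osAdjoint F).appendTensor G := by
    ext x
    rw [hH x, SchwartzMap.appendTensor_apply]
  rw [hHeq]
  exact CurvatureKernel.isOffDiagonal_linActMulti R
    (OSReconstructionNoE1.isOffDiagonal_appendTensor_osAdjoint hF hG)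

omit [NeZero d] in
/-- Pull-backs compose: `linActMulti (R.trans g) = linActMulti g ∘ linActMulti R`. -/
theorem linActMulti_trans {n : ℕ} (R g : 𝔼 ≃ₗᵢ[ℝ] 𝔼) (F : 𝓢((Fin n → 𝔼), ℂ)) :
    linActMulti (R.trans g) F = linActMulti g (linActMulti R F) := by
  ext x
  simp only [linActMulti_apply]
  rfl

/-- **Frame change by a symmetry.** If `S₁` is invariant on `⁰𝒮` under `g`, the pull-back of
`S₁` by `R` is reflection positive as soon as the pull-back by `R.trans g` is. -/
theorem isReflectionPositive_comp_of_trans (S₁ : SchwingerFamily 𝔼) {g : 𝔼 ≃ₗᵢ[ℝ] 𝔼}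
    (hg : ∀ (n : ℕ) (F : 𝓢((Fin n → 𝔼), ℂ)), IsOffDiagonal F → S₁ n (linActMulti g F) = S₁ n F)
    (R : 𝔼 ≃ₗᵢ[ℝ] 𝔼)
    (h : (SchwingerFamily.toLabelled (fun n => (S₁ n).comp (linActMulti (R.trans g)))).IsReflectionPositive) :
    (SchwingerFamily.toLabelled (fun n => (S₁ n).comp (linActMulti R))).IsReflectionPositive := by
  intro N deg lab F hF H hH
  have h' := h N deg lab F hF H hH
  have hkey : ∀ i j, S₁ (deg i + deg j) (linActMulti (R.trans g) (H i j)) =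
      S₁ (deg i + deg j) (linActMulti R (H i j)) := by
    intro i j
    rw [linActMulti_trans]
    exact hg _ _ (isOffDiagonal_linActMulti_of_isAppendTensorOf R (hF i) (hF j) (hH i j))
  simp only [SchwingerFamily.toLabelled_apply, ContinuousLinearMap.comp_apply, hkey] at h'
  simpa only [SchwingerFamily.toLabelled_apply, ContinuousLinearMap.comp_apply] using h'

end TimeAxis

/-! ### Proper signed permutations moving an axis direction of the `(x₀,x₁)`-plane to `e₀` -/

section Frames

local notation "E4" => EuclideanSpace ℝ (Fin 4)
local notation "𝐞" i:max => (EuclideanSpace.single (i : Fin 4) (1 : ℝ) : E4)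
local notation "μ" z:max => (Submodule.reflection (Submodule.span ℝ ({z} : Set E4))ᗮ)

/-- Coordinate vectors are non-zero. -/
theorem single_ne_zero (i : Fin 4) : 𝐞 i ≠ 0 := by
  intro h
  have := congrArg (fun v : E4 => v i) h
  simp at this

/-- `e₀ - e₁ ≠ 0`. -/
theorem single_sub_single_ne_zero : (𝐞 0 - 𝐞 1 : E4) ≠ 0 := by
  intro h
  have := congrArg (fun v : E4 => v 0) h
  simp at this

/-- A hyperplane reflection of `ℝ⁴` has determinant `-1`. -/
theorem det_reflection_of_ne_zero {z : E4} (hz : z ≠ 0) :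
    LinearMap.det ((μ z).toLinearEquiv : E4 →ₗ[ℝ] E4) = -1 := by
  have h := ((Submodule.span ℝ ({z} : Set E4))ᗮ).det_reflection
  rw [Submodule.orthogonal_orthogonal, finrank_span_singleton hz, pow_one] at h
  exact h

/-- The product of two hyperplane reflections of `ℝ⁴` has determinant `1`. -/
theorem det_reflection_trans_reflection {z w : E4} (hz : z ≠ 0) (hw : w ≠ 0) :
    LinearMap.det (((μ z).trans (μ w)).toLinearEquiv : E4 →ₗ[ℝ] E4) = 1 := by
  rw [LinearIsometryEquiv.toLinearEquiv_trans, LinearEquiv.coe_trans, LinearMap.det_comp,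
    det_reflection_of_ne_zero hz, det_reflection_of_ne_zero hw]
  norm_num

/-- The mirror `⊥ eᵢ` negates `eᵢ`. -/
theorem reflection_single_self (i : Fin 4) : (μ (𝐞 i)) (𝐞 i) = -𝐞 i :=
  Submodule.reflection_orthogonalComplement_singleton_eq_neg _

/-- The mirror `⊥ eᵢ` fixes `eⱼ` for `j ≠ i`. -/
theorem reflection_single_of_ne {i j : Fin 4} (hij : i ≠ j) : (μ (𝐞 i)) (𝐞 j) = 𝐞 j :=
  Submodule.reflection_mem_subspace_eq_self (by
    rw [Submodule.mem_orthogonal_singleton_iff_inner_right, EuclideanSpace.inner_single_left]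
    simp [hij])

/-- The diagonal mirror `⊥ (e₀ - e₁)` swaps `e₀ ↦ e₁`. -/
theorem reflection_diag_single_zero : (μ (𝐞 0 - 𝐞 1)) (𝐞 0) = 𝐞 1 :=
  Submodule.reflection_sub (by simp)

/-- The diagonal mirror `⊥ (e₀ - e₁)` swaps `e₁ ↦ e₀`. -/
theorem reflection_diag_single_one : (μ (𝐞 0 - 𝐞 1)) (𝐞 1) = 𝐞 0 := by
  have h := Submodule.reflection_reflection (Submodule.span ℝ ({𝐞 0 - 𝐞 1} : Set E4))ᗮ (𝐞 0)
  rw [reflection_diag_single_zero] at h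
  exact h

/-- The diagonal mirror `⊥ (e₀ - e₁)` fixes `eⱼ` for `j ≠ 0, 1`. -/
theorem reflection_diag_single_of_ne {j : Fin 4} (h0 : j ≠ 0) (h1 : j ≠ 1) :
    (μ (𝐞 0 - 𝐞 1)) (𝐞 j) = 𝐞 j :=
  Submodule.reflection_mem_subspace_eq_self (by
    rw [Submodule.mem_orthogonal_singleton_iff_inner_right, inner_sub_left,
      EuclideanSpace.inner_single_left, EuclideanSpace.inner_single_left]
    simp [h0, h1])

/-- For each axis direction `v ∈ {-e₀, e₁, -e₁}` there is a proper signed permutation `g` of `ℝ⁴`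
(a product of two mirrors) with `g v = e₀`. -/
theorem exists_signedPerm_apply_eq_single_zero {v : E4} (hv : v = -𝐞 0 ∨ v = 𝐞 1 ∨ v = -𝐞 1) :
    ∃ g : E4 ≃ₗᵢ[ℝ] E4, LinearMap.det (g.toLinearEquiv : E4 →ₗ[ℝ] E4) = 1 ∧
      (∀ i : Fin 4, ∃ j : Fin 4, g (EuclideanSpace.single i 1) = EuclideanSpace.single j 1 ∨
        g (EuclideanSpace.single i 1) = -EuclideanSpace.single j 1) ∧
      g v = 𝐞 0 := by
  rcases hv with rfl | rfl | rfl
  · -- `diag(-1,-1,1,1)`: the mirror `⊥ e₀` followed by the mirror `⊥ e₁`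
    refine ⟨(μ (𝐞 0)).trans (μ (𝐞 1)),
      det_reflection_trans_reflection (single_ne_zero 0) (single_ne_zero 1), fun i => ⟨i, ?_⟩, ?_⟩
    · fin_cases i
      · exact Or.inr (by simp [reflection_single_self, reflection_single_of_ne])
      · exact Or.inr (by simp [reflection_single_self, reflection_single_of_ne])
      · exact Or.inl (by simp [reflection_single_of_ne])
      · exact Or.inl (by simp [reflection_single_of_ne])
    · simp [reflection_single_self, reflection_single_of_ne]
  · -- `e₁ ↦ e₀ ↦ … `: the mirror `⊥ e₀` followed by the diagonal mirror
    refine ⟨(μ (𝐞 0)).trans (μ (𝐞 0 - 𝐞 1)),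
      det_reflection_trans_reflection (single_ne_zero 0) single_sub_single_ne_zero, fun i => ?_, ?_⟩
    · fin_cases i
      · exact ⟨1, Or.inr (by simp [reflection_single_self, reflection_diag_single_zero])⟩
      · exact ⟨0, Or.inl (by simp [reflection_single_of_ne, reflection_diag_single_one])⟩
      · exact ⟨2, Or.inl (by simp [reflection_single_of_ne, reflection_diag_single_of_ne])⟩
      · exact ⟨3, Or.inl (by simp [reflection_single_of_ne, reflection_diag_single_of_ne])⟩
    · simp [reflection_single_of_ne, reflection_diag_single_one]
  · -- `-e₁ ↦ -e₀ ↦ e₀`: the diagonal mirror followed by the mirror `⊥ e₀`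
    refine ⟨(μ (𝐞 0 - 𝐞 1)).trans (μ (𝐞 0)),
      det_reflection_trans_reflection single_sub_single_ne_zero (single_ne_zero 0), fun i => ?_, ?_⟩
    · fin_cases i
      · exact ⟨1, Or.inl (by simp [reflection_single_of_ne, reflection_diag_single_zero])⟩
      · exact ⟨0, Or.inr (by simp [reflection_single_self, reflection_diag_single_one])⟩
      · exact ⟨2, Or.inl (by simp [reflection_single_of_ne, reflection_diag_single_of_ne])⟩
      · exact ⟨3, Or.inl (by simp [reflection_single_of_ne, reflection_diag_single_of_ne])⟩
    · simp [reflection_single_self, reflection_diag_single_one]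

/-- **Axis frames.** A one-species family on `ℝ⁴` that is reflection positive and invariant on
`⁰𝒮` under the proper signed permutations is reflection positive in pull-back form for every
frame `R` with `R e₀ = a e₀ + b e₁`, `a² + b² = 1`, `a = 0 ∨ b = 0` (i.e. `R e₀ ∈ {±e₀, ±e₁}`). -/
theorem isReflectionPositive_comp_axisFrame (S₁ : SchwingerFamily E4)
    (hRP : S₁.toLabelled.IsReflectionPositive)
    (hHyp : ∀ R : E4 ≃ₗᵢ[ℝ] E4, LinearMap.det (R.toLinearEquiv : E4 →ₗ[ℝ] E4) = 1 →
      (∀ i : Fin 4, ∃ j : Fin 4, R (EuclideanSpace.single i 1) = EuclideanSpace.single j 1 ∨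
        R (EuclideanSpace.single i 1) = -EuclideanSpace.single j 1) →
      ∀ (n : ℕ) (F : 𝓢((Fin n → E4), ℂ)), IsOffDiagonal F → S₁ n (linActMulti R F) = S₁ n F)
    (R : E4 ≃ₗᵢ[ℝ] E4) (a b : ℝ) (hab : a ^ 2 + b ^ 2 = 1) (h0 : a = 0 ∨ b = 0)
    (hR : R (EuclideanSpace.single 0 1) =
      a • EuclideanSpace.single 0 1 + b • EuclideanSpace.single 1 1) :
    (SchwingerFamily.toLabelled (fun n => (S₁ n).comp (linActMulti R))).IsReflectionPositive := by
  -- `R e₀` is one of `e₀, -e₀, e₁, -e₁`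
  have hv : R (𝐞 0) = 𝐞 0 ∨ (R (𝐞 0) = -𝐞 0 ∨ R (𝐞 0) = 𝐞 1 ∨ R (𝐞 0) = -𝐞 1) := by
    rcases h0 with rfl | rfl
    · have hb : b * b = 1 := by nlinarith [hab]
      rcases mul_self_eq_one_iff.mp hb with rfl | rfl
      · exact Or.inr (Or.inr (Or.inl (by rw [hR]; simp)))
      · exact Or.inr (Or.inr (Or.inr (by rw [hR]; simp)))
    · have ha : a * a = 1 := by nlinarith [hab]
      rcases mul_self_eq_one_iff.mp ha with rfl | rfl
      · exact Or.inl (by rw [hR]; simp)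
      · exact Or.inr (Or.inl (by rw [hR]; simp))
  rcases hv with hv | hv
  · -- `R` itself fixes the time axis
    exact isReflectionPositive_comp_of_map_e0 S₁ hRP hv
  · obtain ⟨g, hdet, hsp, hg⟩ := exists_signedPerm_apply_eq_single_zero hv
    refine isReflectionPositive_comp_of_trans S₁ (hHyp g hdet hsp) R ?_
    exact isReflectionPositive_comp_of_map_e0 S₁ hRP (Q := R.trans g) (by
      show g (R _) = _
      exact hg)

end Frames

end CurvatureChannel

open CurvatureChannel in
/-- **`PencilRigidity.CurvatureChannel` holds** (item stmt-QuantumFields-9666, shared with route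
`MirrorModularBoosts`): the curvature channel `S₁ n := S n (fun _ => r.curvature)` of a labelled
family `S` with the `HypercubicLimit` clauses carries the one-species package `W₁` (label
specialisation; the gap by `HasMassGap.restrict`) and is reflection positive in pull-back form
for the four axis frames `R e₀ ∈ {±e₀, ±e₁}` (E2 transported by a proper signed permutation and
an isometry fixing the time axis). -/
theorem curvatureChannel_proof :
    Summit.QuantumFields.YangMills.Theses.PencilRigidity.CurvatureChannel := by
  intro G _ _ _ _ hG
  letI : MeasurableSpace G := borel G
  haveI : BorelSpace G := ⟨rfl⟩
  dsimp only
  intro r sch S hW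
  obtain ⟨⟨hnorm, hherm, hgrowth, hrp, hsymm, hclus, htr, hhyp⟩, hconv, -, -, Δ, hΔ, hgap, hlat⟩ :=
    hW
  -- E2 of the curvature channel (label specialisation)
  have hrp₁ : (SchwingerFamily.toLabelled (fun n => S n fun _ => r.curvature)).IsReflectionPositive := by
    intro N deg lab F hF H hH
    have h := hrp N deg (fun j _ => r.curvature) F hF H hH
    simp only [append_const_rev] at h
    simpa only [SchwingerFamily.toLabelled_apply] using h
  -- proper hypercubic invariance of the curvature channel on `⁰𝒮`
  have hhyp₁ : ∀ R : EuclideanSpace ℝ (Fin 4) ≃ₗᵢ[ℝ] EuclideanSpace ℝ (Fin 4),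
      LinearMap.det (R.toLinearEquiv : EuclideanSpace ℝ (Fin 4) →ₗ[ℝ] EuclideanSpace ℝ (Fin 4)) = 1 →
      (∀ i : Fin 4, ∃ j : Fin 4, R (EuclideanSpace.single i 1) = EuclideanSpace.single j 1 ∨
        R (EuclideanSpace.single i 1) = -EuclideanSpace.single j 1) →
      ∀ (n : ℕ) (F : 𝓢((Fin n → EuclideanSpace ℝ (Fin 4)), ℂ)), IsOffDiagonal F →
        S n (fun _ => r.curvature) (linActMulti R F) = S n (fun _ => r.curvature) F :=
    fun R hdet hsp n F hF => hhyp n (fun _ => r.curvature) R hdet hsp F hF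
  refine ⟨⟨?_, ⟨?_, ?_, ?_, hrp₁, ?_, ?_⟩, ?_, hhyp₁, Δ, hΔ, ?_, hlat⟩, ?_⟩
  · -- lattice convergence of the curvature strings
    exact fun n hn f F hF hF' => hconv n hn (fun _ => r.curvature) f F hF hF'
  · -- E0 (normalisation)
    exact fun k F => hnorm (fun _ => r.curvature) F
  · -- E0 (hermiticity)
    exact fun n k F hF => hherm n (fun _ => r.curvature) F hF
  · -- E0' with the label alphabet `{r.curvature}`
    intro T
    obtain ⟨s, α, β, h⟩ := hgrowth {r.curvature}
    exact ⟨s, α, β, fun n k _ F hF =>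
      h n (fun _ => r.curvature) (fun _ => Finset.mem_singleton_self _) F hF⟩
  · -- E3
    exact fun n k π F hF => hsymm n (fun _ => r.curvature) π F hF
  · -- E4
    intro n m k k' F G' hF hG' a ha ha' H hH
    have h := hclus n m (fun _ => r.curvature) (fun _ => r.curvature) F G' hF hG' a ha ha' H hH
    rw [append_const_rev] at h
    exact h
  · -- translations
    exact fun n a F hF => htr n (fun _ => r.curvature) a F hF
  · -- the gap of the curvature sector
    exact hgap.restrict fun _ => r.curvature
  · -- reflection positivity in the four axis frames
    intro R a b hab h0 hR
    exact isReflectionPositive_comp_axisFrame (fun n => S n fun _ => r.curvature) hrp₁ hhyp₁ R a b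
      hab h0 hR


end Summit.QuantumFields.YangMills.Theorems

end
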